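import Mathlib
import Summits.ValiantsHypothesis.ValiantsHypothesis.Theorems.BarrierLeverPartitionMinorsHitByVPSimplexJoinBoxGameStaticLaw

/-!
# Route BarrierLever — item `PartitionMinorsHitByVP` (stmt-ValiantsHypothesis-19717), line `hidden_states`:
# THE MULTI-CUBE LAW — `k` column-disjoint binary `(t+1)`-cubes (in any pieces) are dead up to `r < B_t(hd) + k`

Helper file (`--supports stmt-ValiantsHypothesis-19717`; cell valiant-natproofs, rung V4, 𝒟-side door (c), line
`Cruxes/PartitionMinorsHitByVP/Lines/hidden_states.lean` v8, registered stub `stub_simplexPairLower`; prover seat val-np-p3 gen 15).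
Definition-free. Closes NO item. Fourth file of the series p661257 / p663975 / p664837 (transfer principle; dimension law; rectangle law;
static box law) — the first law of the series that constrains SEVERAL PIECES AT ONCE.

THE LAW (`det_simplexMatrix_eq_zero_of_cubes`, `not_boxWinning_cubes[_layerCake]`). Let the position `e` contain `k` binary `(t+1)`-cubes of
columns `i l : (Fin (t+1) → Fin 2) → Fin r` (`l < k`), each inside one piece (possibly different pieces for different `l`) with every slot
reading one cube coordinate, and all `k·2^{t+1}` columns distinct. Against a row family with members of size `≤ t+1`, FEWER THAN `k` of them
of size `t+1`, the simplex matrix is singular for every table: each cube's alternating column vector kills every row of size `≤ t`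
(`cube_altSum_eq_zero`, the computation of p661257), a row of size `t+1` is ONE linear condition on the `k` coefficients of a combination
of the `k` alternating vectors, so fewer than `k` such rows leave a nonzero combination (`LinearMap.ker_ne_bot_of_finrank_lt`), which is a
nonzero kernel vector because the cubes are column-disjoint. By the transfer principle: for EVERY box-game winning predicate `W` (either
floor), `¬ W hd r e` whenever `r < B_t(hd) + k`, `r ≤ B_{t+1}(hd)`, `k ≥ 1`. Examples (val-np-p3 g15 exact census, lab/probe4.py, sharp floor):
`k` squares (2,2) in distinct pieces are statically dead up to `r ≤ hd + k` (game threshold `hd + 2k`: dynamic excess `k − 1`); `k` cubes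
(2,2,2) up to `r ≤ B₂(hd) + k − 1` (game: `B₂ + 2k − 1`). `k = 1` is the dimension law of p661257.

WHAT THIS IS NOT: a necessary condition on winning predicates; `Stmt.simplexPairLower` and item 19717 stay OPEN; nothing on crux 14610 or
VP ≠ VNP.
-/

set_option linter.dupNamespace false

namespace Summit.ValiantsHypothesis.ValiantsHypothesis.Theorems.BarrierLever.SimplexJoin.Cut

open Finset Matrix MvPolynomial
open Summit.ValiantsHypothesis.ValiantsHypothesis.Theorems.BarrierLever.HiddenStates

noncomputable section

/-! ## 1. One cube: the alternating row sum vanishes on every row of size `≤ t` -/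

/-- **Per-cube alternating sums.** For a binary `(t+1)`-cube of columns `i` inside one piece, each slot reading one cube coordinate,
and a row `u row` of size `≤ t`: `Σ_z (−1)^{|z|} · entry(row, i z) = 0` for every table (the entry is the value of a polynomial of
total degree `≤ t` on `{0,1}^{t+1}`; `altSum_eval_eq_zero`, p661257). Injectivity of `i` is not needed. -/
theorem cube_altSum_eq_zero {m D N h r t : ℕ}
    (u : Fin r → Finset (Fin h)) (row : Fin r) (hrow : (u row).card ≤ t)
    (e : Fin r → Fin m × (Fin D → Option (Fin N))) (i : (Fin (t + 1) → Fin 2) → Fin r)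
    (hpiece : ∀ z, (e (i z)).1 = (e (i fun _ => 0)).1)
    (hcube : ∀ φ : Fin D, ∃ c : Fin (t + 1), ∀ z z', z c = z' c → (e (i z)).2 φ = (e (i z')).2 φ)
    (tx : Fin m → Option (Fin D × Fin N) → Fin h → ℂ) :
    ∑ z : Fin (t + 1) → Fin 2, (∏ c', (if z c' = 1 then (-1 : ℂ) else 1)) *
      ∏ a ∈ u row, (tx (e (i z)).1 none a + ∑ f : Fin D, ((e (i z)).2 f).elim 0 fun j => tx (e (i z)).1 (some (f, j)) a) = 0 := by
  classical
  set p : Fin m := (e (i fun _ => 0)).1 with hp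
  choose c hc using hcube
  let sv : Fin D → Fin 2 → Fin h → ℂ := fun f b a => ((e (i fun _ => b)).2 f).elim 0 fun j => tx p (some (f, j)) a
  have hsv : ∀ z f a, (((e (i z)).2 f).elim 0 fun j => tx p (some (f, j)) a) = sv f (z (c f)) a := by
    intro z f a
    have hzf : (e (i z)).2 f = (e (i fun _ => z (c f))).2 f := hc f z (fun _ => z (c f)) rfl
    simp only [sv, hzf]
  let ℓ : Fin h → MvPolynomial (Fin (t + 1)) ℂ := fun a =>
    C (tx p none a) + ∑ f : Fin D, (C (sv f 0 a) + C (sv f 1 a - sv f 0 a) * X (c f))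
  have hℓdeg : ∀ a, (ℓ a).totalDegree ≤ 1 := by
    intro a
    refine (totalDegree_add _ _).trans (max_le (by rw [totalDegree_C]; exact Nat.zero_le _) ?_)
    refine totalDegree_finsetSum_le fun f _ => ?_
    refine (totalDegree_add _ _).trans (max_le (by rw [totalDegree_C]; exact Nat.zero_le _) ?_)
    refine (totalDegree_mul _ _).trans ?_
    rw [totalDegree_C, totalDegree_X, zero_add]
  have hℓeval : ∀ (z : Fin (t + 1) → Fin 2) a,
      MvPolynomial.eval (fun c' => if z c' = 1 then (1 : ℂ) else 0) (ℓ a) = tx p none a + ∑ f : Fin D, sv f (z (c f)) a := by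
    intro z a
    simp only [ℓ, map_add, map_sum, map_mul, eval_C, eval_X]
    congr 1
    refine Finset.sum_congr rfl fun f _ => ?_
    rcases Fin.exists_fin_two.mp ⟨z (c f), rfl⟩ with h0 | h1
    · rw [h0]; simp
    · rw [h1]; simp
  let Q : MvPolynomial (Fin (t + 1)) ℂ := ∏ a ∈ u row, ℓ a
  have hQdeg : Q.totalDegree < t + 1 := by
    refine Nat.lt_succ_of_le ?_
    calc Q.totalDegree ≤ ∑ a ∈ u row, (ℓ a).totalDegree := totalDegree_finsetProd _ _
      _ ≤ ∑ a ∈ u row, 1 := Finset.sum_le_sum fun a _ => hℓdeg a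
      _ = (u row).card := by simp
      _ ≤ t := hrow
  have hQeval : ∀ z : Fin (t + 1) → Fin 2,
      MvPolynomial.eval (fun c' => if z c' = 1 then (1 : ℂ) else 0) Q
        = ∏ a ∈ u row, (tx (e (i z)).1 none a + ∑ f : Fin D, ((e (i z)).2 f).elim 0 fun j => tx (e (i z)).1 (some (f, j)) a) := by
    intro z
    rw [map_prod]
    refine Finset.prod_congr rfl fun a _ => ?_
    rw [hℓeval, hpiece z]
    congr 1
    exact Finset.sum_congr rfl fun f _ => (hsv z f a).symm
  have := altSum_eval_eq_zero Q hQdeg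
  simp_rw [hQeval] at this
  exact this

/-! ## 2. Several column-disjoint cubes against fewer than `k` rows of size `t+1` -/

/-- **The multi-cube law (numeric form, every table).** `k` binary `(t+1)`-cubes `i l`, each in one piece with slots reading one cube
coordinate, all `k·2^{t+1}` columns distinct; rows of size `≤ t+1`, fewer than `k` of size `t+1`. Then the simplex matrix is singular. -/
theorem det_simplexMatrix_eq_zero_of_cubes {m D N h r t k : ℕ}
    (u : Fin r → Finset (Fin h)) (hut : ∀ row, (u row).card ≤ t + 1)
    (hq : (Finset.univ.filter fun row => (u row).card = t + 1).card < k)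
    (e : Fin r → Fin m × (Fin D → Option (Fin N))) (i : Fin k → (Fin (t + 1) → Fin 2) → Fin r)
    (hinj : Function.Injective fun lz : Fin k × (Fin (t + 1) → Fin 2) => i lz.1 lz.2)
    (hpiece : ∀ l z, (e (i l z)).1 = (e (i l fun _ => 0)).1)
    (hcube : ∀ l (φ : Fin D), ∃ c : Fin (t + 1), ∀ z z', z c = z' c → (e (i l z)).2 φ = (e (i l z')).2 φ)
    (tx : Fin m → Option (Fin D × Fin N) → Fin h → ℂ) :
    (Matrix.of fun row col : Fin r => ∏ a ∈ u row,
      (tx (e col).1 none a + ∑ f : Fin D, ((e col).2 f).elim 0 fun j => tx (e col).1 (some (f, j)) a)).det = 0 := by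
  classical
  set M : Matrix (Fin r) (Fin r) ℂ := Matrix.of fun row col : Fin r => ∏ a ∈ u row,
      (tx (e col).1 none a + ∑ f : Fin D, ((e col).2 f).elim 0 fun j => tx (e col).1 (some (f, j)) a) with hM
  let sgn : (Fin (t + 1) → Fin 2) → ℂ := fun z => ∏ c', (if z c' = 1 then (-1 : ℂ) else 1)
  -- per-cube alternating row sums
  let A : Fin k → Fin r → ℂ := fun l row => ∑ z : Fin (t + 1) → Fin 2, sgn z * M row (i l z)
  have hAsmall : ∀ l row, (u row).card ≤ t → A l row = 0 := by
    intro l row hrow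
    simp only [A, hM, Matrix.of_apply]
    exact cube_altSum_eq_zero u row hrow e (i l) (hpiece l) (hcube l) tx
  -- the rows of size `t+1` impose fewer than `k` linear conditions on the coefficients
  let Rows := {row : Fin r // (u row).card = t + 1}
  let L : (Fin k → ℂ) →ₗ[ℂ] (Rows → ℂ) :=
    { toFun := fun lam q => ∑ l, lam l * A l q.1
      map_add' := fun lam lam' => by
        funext q
        simp only [Pi.add_apply, add_mul, Finset.sum_add_distrib]
      map_smul' := fun s lam => by
        funext q
        simp only [Pi.smul_apply, smul_eq_mul, RingHom.id_apply, mul_assoc, Finset.mul_sum] }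
  have hlt : Module.finrank ℂ (Rows → ℂ) < Module.finrank ℂ (Fin k → ℂ) := by
    rw [Module.finrank_fintype_fun_eq_card, Module.finrank_fintype_fun_eq_card, Fintype.card_subtype, Fintype.card_fin]
    exact hq
  obtain ⟨lam, hker, hne⟩ := (Submodule.ne_bot_iff _).mp (LinearMap.ker_ne_bot_of_finrank_lt (f := L) hlt)
  have hbig : ∀ q : Rows, ∑ l, lam l * A l q.1 = 0 := by
    intro q
    have h0 : L lam = 0 := LinearMap.mem_ker.mp hker
    exact congrFun h0 q
  have hrow : ∀ row, ∑ l, lam l * A l row = 0 := by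
    intro row
    by_cases hfull : (u row).card = t + 1
    · exact hbig ⟨row, hfull⟩
    · have hsmall : (u row).card ≤ t := by have := hut row; omega
      simp_rw [hAsmall _ row hsmall, mul_zero, Finset.sum_const_zero]
  -- the kernel vector: the combination of the alternating vectors of the cubes
  let v : Fin r → ℂ := fun col =>
    ∑ lz ∈ Finset.univ.filter (fun lz : Fin k × (Fin (t + 1) → Fin 2) => i lz.1 lz.2 = col), lam lz.1 * sgn lz.2
  have hv : v ≠ 0 := by
    have hlam' : ∃ l₀, lam l₀ ≠ 0 := by
      by_contra hno
      push Not at hno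
      exact hne (funext hno)
    obtain ⟨l₀, hl₀⟩ := hlam'
    intro hv0
    have h0 := congrFun hv0 (i l₀ fun _ => 0)
    have hfil : (Finset.univ.filter fun lz : Fin k × (Fin (t + 1) → Fin 2) => i lz.1 lz.2 = i l₀ fun _ => 0)
        = {(l₀, fun _ => 0)} := by
      ext lz
      simp only [Finset.mem_filter, Finset.mem_univ, true_and, Finset.mem_singleton]
      constructor
      · intro hz
        exact hinj (a₁ := lz) (a₂ := (l₀, fun _ => 0)) hz
      · intro hz; rw [hz]
    simp only [v, hfil, Finset.sum_singleton, sgn, Pi.zero_apply] at h0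
    simp only [Fin.isValue, zero_ne_one, ↓reduceIte, Finset.prod_const_one, mul_one] at h0
    exact hl₀ h0
  apply Matrix.exists_mulVec_eq_zero_iff.mp
  refine ⟨v, hv, ?_⟩
  funext row
  rw [Pi.zero_apply, Matrix.mulVec, dotProduct]
  calc ∑ col, M row col * v col
      = ∑ col, ∑ lz ∈ Finset.univ.filter (fun lz : Fin k × (Fin (t + 1) → Fin 2) => i lz.1 lz.2 = col),
          lam lz.1 * (sgn lz.2 * M row (i lz.1 lz.2)) := by
        refine Finset.sum_congr rfl fun col _ => ?_
        rw [Finset.mul_sum]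
        exact Finset.sum_congr rfl fun lz hz => by rw [(Finset.mem_filter.mp hz).2]; ring
    _ = ∑ lz : Fin k × (Fin (t + 1) → Fin 2), lam lz.1 * (sgn lz.2 * M row (i lz.1 lz.2)) :=
        Finset.sum_fiberwise Finset.univ (fun lz : Fin k × (Fin (t + 1) → Fin 2) => i lz.1 lz.2)
          (fun lz => lam lz.1 * (sgn lz.2 * M row (i lz.1 lz.2)))
    _ = ∑ l, lam l * A l row := by
        rw [Fintype.sum_prod_type]
        refine Finset.sum_congr rfl fun l _ => ?_
        rw [Finset.mul_sum]
    _ = 0 := hrow row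

/-! ## 3. The multi-cube law for box-game winning predicates (both floors) -/

/-- **THE MULTI-CUBE LAW (crude floor).** For every box-game winning predicate `W` (p647518): if `r < B_t(hd) + k`, `r ≤ B_{t+1}(hd)`,
`k ≥ 1`, and the position `e` contains `k` column-disjoint binary `(t+1)`-cubes, each inside one piece with every slot reading one cube
coordinate, then `¬ W hd r e`. (`k = 1`: the dimension law of p661257.) -/
theorem not_boxWinning_cubes {m D N : ℕ}
    (W : (hd : ℕ) → (r : ℕ) → (Fin r → Fin m × (Fin D → Option (Fin N))) → Prop)
    (hwin : ∀ (hd r : ℕ) (e : Fin r → Fin m × (Fin D → Option (Fin N))), W hd r e → 2 ≤ r → 1 ≤ hd →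
      ∀ r₀ r₁ : ℕ, r₀ + r₁ = r → (r - 2) / hd + 1 ≤ r₁ → r₁ ≤ r₀ → r₀ ≤ 2 ^ (hd - 1) →
        ∃ (f : Fin m → Fin D) (side : Fin m → Option (Fin N) → Bool) (g₀ : Fin r₀ → Fin r) (g₁ : Fin r₁ → Fin r),
          Function.Injective (Sum.elim g₀ g₁) ∧
          (∀ j, side (e (g₀ j)).1 ((e (g₀ j)).2 (f (e (g₀ j)).1)) = false) ∧
          (∀ j, side (e (g₁ j)).1 ((e (g₁ j)).2 (f (e (g₁ j)).1)) = true) ∧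
          W (hd - 1) r₀ (fun j => e (g₀ j)) ∧ W (hd - 1) r₁ (fun j => e (g₁ j)))
    (t k : ℕ) (hk : 0 < k) :
    ∀ (r hd : ℕ) (e : Fin r → Fin m × (Fin D → Option (Fin N))) (i : Fin k → (Fin (t + 1) → Fin 2) → Fin r),
      r < (∑ j ∈ Finset.range (t + 1), hd.choose j) + k → r ≤ ∑ j ∈ Finset.range (t + 2), hd.choose j →
      (Function.Injective fun lz : Fin k × (Fin (t + 1) → Fin 2) => i lz.1 lz.2) →
      (∀ l z, (e (i l z)).1 = (e (i l fun _ => 0)).1) →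
      (∀ l (φ : Fin D), ∃ c : Fin (t + 1), ∀ z z', z c = z' c → (e (i l z)).2 φ = (e (i l z')).2 φ) →
      ¬ W hd r e := by
  intro r hd e i hr hr2 hinj hpiece hcube
  obtain ⟨u, hu, hlow, hut, hq⟩ := exists_lower_family_topRows hd t k r hr hr2 hk
  exact not_boxWinning_of_singular W hwin hd r e u hu hlow
    (fun tx => det_simplexMatrix_eq_zero_of_cubes u hut hq e i hinj hpiece hcube tx)

/-- **THE MULTI-CUBE LAW (layer-cake floor).** As `not_boxWinning_cubes`, for the sharp-floor box game of p656478. -/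
theorem not_boxWinning_cubes_layerCake {m D N : ℕ}
    (W : (hd : ℕ) → (r : ℕ) → (Fin r → Fin m × (Fin D → Option (Fin N))) → Prop)
    (hwin : ∀ (hd r : ℕ) (e : Fin r → Fin m × (Fin D → Option (Fin N))), W hd r e → 2 ≤ r → 1 ≤ hd →
      ∀ r₀ r₁ : ℕ, r₀ + r₁ = r →
        (∑ d ∈ Finset.range hd, (r - ∑ j ∈ Finset.range (d + 1), hd.choose j) + hd - 1) / hd ≤ r₁ → r₁ ≤ r₀ →
        r₀ ≤ 2 ^ (hd - 1) →
        ∃ (f : Fin m → Fin D) (side : Fin m → Option (Fin N) → Bool) (g₀ : Fin r₀ → Fin r) (g₁ : Fin r₁ → Fin r),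
          Function.Injective (Sum.elim g₀ g₁) ∧
          (∀ j, side (e (g₀ j)).1 ((e (g₀ j)).2 (f (e (g₀ j)).1)) = false) ∧
          (∀ j, side (e (g₁ j)).1 ((e (g₁ j)).2 (f (e (g₁ j)).1)) = true) ∧
          W (hd - 1) r₀ (fun j => e (g₀ j)) ∧ W (hd - 1) r₁ (fun j => e (g₁ j)))
    (t k : ℕ) (hk : 0 < k) :
    ∀ (r hd : ℕ) (e : Fin r → Fin m × (Fin D → Option (Fin N))) (i : Fin k → (Fin (t + 1) → Fin 2) → Fin r),
      r < (∑ j ∈ Finset.range (t + 1), hd.choose j) + k → r ≤ ∑ j ∈ Finset.range (t + 2), hd.choose j →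
      (Function.Injective fun lz : Fin k × (Fin (t + 1) → Fin 2) => i lz.1 lz.2) →
      (∀ l z, (e (i l z)).1 = (e (i l fun _ => 0)).1) →
      (∀ l (φ : Fin D), ∃ c : Fin (t + 1), ∀ z z', z c = z' c → (e (i l z)).2 φ = (e (i l z')).2 φ) →
      ¬ W hd r e := by
  intro r hd e i hr hr2 hinj hpiece hcube
  obtain ⟨u, hu, hlow, hut, hq⟩ := exists_lower_family_topRows hd t k r hr hr2 hk
  exact not_boxWinning_of_singular_layerCake W hwin hd r e u hu hlow
    (fun tx => det_simplexMatrix_eq_zero_of_cubes u hut hq e i hinj hpiece hcube tx)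

end

end Summit.ValiantsHypothesis.ValiantsHypothesis.Theorems.BarrierLever.SimplexJoin.Cut
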